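import Mathlib
import HarnessLib
import Summits.HubbardSuperconductivity.HubbardSuperconductivity.Theorems.KLProgrammeKLRegimeSplitBornOddness
import Summits.HubbardSuperconductivity.HubbardSuperconductivity.Theorems.KLProgrammeKLRegimeEngineFrameOddMomentumSum
import Summits.HubbardSuperconductivity.HubbardSuperconductivity.Theorems.KLProgrammeKLRegimeEngineFlowLineDictionary
import Summits.HubbardSuperconductivity.HubbardSuperconductivity.Theorems.KLProgrammeKLRegimeEngineTwoShellLatticeMassSharp
import Summits.HubbardSuperconductivity.HubbardSuperconductivity.Theorems.KLProgrammeMatsubaraSliceBubbleTransfer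

/-!
# Route `KLProgramme` — ENGINE (stmt-HubbardSuperconductivity-20437 `KLRegimeEngineV17F2`), cure (C′) of located #22, brick O5a:
# THE LOCALISED BORN KERNEL SUM — a radial slice weight `G(ω² + e_K²)` against `ĝ²·(zω·iω + ze·e_K)`, summed over ALL frequency–momenta,
# is `O(Λ³L²·β/Λ³) = O(βL²·Λ⁰)`-free of the DOS: it is bounded by the DOS-SLOPE size `(jacR/π)·Λ_t²·(βL²)·const + lattice rounding`
# (cell gate-hubbard-kl, seat hubbard-kl-k3c2-p2 g31, technique «thermal-bar induction n ≤ nScales β + 1 with EngineBoundsAtV4S sums»)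

WHY.  CURE-C-PRIME-DESIGN §2 row 1: the leading (localised, BGM §2.9 `ℒΣ = zω·iω + ze·e_K`) part of binder #9's self-energy line against the born kernel
`Ẇ_t(p)·Φ_j(p)·ĝ_K(p)²` of the rows door.  Chain: O1 §5 (`klod_sum_even_mul_propCT_sq_mul_linForm`: the frequency sum is `e_K × (even in e_K)`) → this
file's §1–§3 (the even factors are radial Matsubara sums `S₁(e) = Σ_ν G(s_ν)/s_ν`, `S₂(e) = Σ_ν G(s_ν)/s_ν²`, `s_ν = ω_ν² + e²`, bounded and Lipschitz
in `e²` by the frequency count `r₂β/π + 1` times the `klsp_div_*` quotient constants; hence `e·S₁(e)` and `e³·S₂(e)` are ODD, vanish for `|e| ≥ r₂`,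
and are Lipschitz on `[−2r₂, 2r₂]`) → O2∘O3 (`abs_sum_shell_odd_le_of_lipschitzOn`: odd Lipschitz level functions summed over the slice shell of the
frame band are `≤ Λ·C·(L/2π)²·(4π·jacR·Λ² + 4Dδ)`).

* §1 `klok_div_*`, `klok_divSq_*` — real quotients `G/s`, `G/s²` of a slice weight (`|G| ≤ M_G`, `ℓ`-Lipschitz, `G = 0` for `s ≤ r₁²`): bounds, Lipschitz, vanishing;
* §2 `klok_sumDiv_*`, `klok_sumDivSq_*` — the radial Matsubara sums `S₁, S₂`: support `ω_ν² < r₂²`, bounds `N·M_G/r₁²`, `N·M_G/r₁⁴`, Lipschitz in `e²`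
  (`N = r₂β/π + 1`, `card_filter_matsubaraFreq_le_sharp`);
* §3 `klok_odd₁_lipschitzOn`, `klok_odd₃_lipschitzOn` — `e ↦ e·S₁(e)` and `e ↦ e³·S₂(e)` are Lipschitz on `[−ρ, ρ]` with explicit constants; odd; zero off the shell;
* §4 **`klok_localisedBorn_sum_norm_le`** — for every real slice weight `G` as above, every `zω ze : ℂ`, under the C4a chart hypotheses and
  `r₂ + (4 + 2A)·2π/L < r`:  `‖Σ_{(ν,k̃)} G(ω_ν² + e_K(p_k̃)²)·ĝ_K(ν,k̃)²·(zω·iω_ν + ze·e_K(p_k̃))‖ ≤ (‖2zω + ze‖·C₁ + 2‖zω + ze‖·C₃)·r₂·(L/2π)²·(4π·jacR·r₂² + 4·D·δ)`,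
  `C₁, C₃` the §3 constants at `ρ = 2r₂`, `D = 2π·π√2/(Dt_min − 2A)`, `δ = (4 + 2A)·2π/L`;
* §5 `klok_bornKernel_hypotheses` — the rows door's kernel `G = klWd Λ_t · klPhi Λ_j Λ_t` (`Ẇ_t·Φ_j` as functions of `s`) satisfies §1's hypotheses with
  `M_G = 8/Λ_t`, `ℓ = 64/(Λ_t·Λ_j²) + (2·(448/3)e² + 8)/Λ_t³`, `r₁ = Λ_t/2`, `r₂ = Λ_t`.
Pure analysis + the tree's identities; no definitions; nothing asserts (c), K3 or superconductivity.
References: BGM 2006 §2.9 (localisation), §2.4 (2.40)–(2.41) [cite: BenfattoGiulianiMastropietro2006]; FST II App. B [cite: FeldmanSalmhoferTrubowitz1998].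
-/

noncomputable section

namespace Summit.HubbardSuperconductivity.HubbardSuperconductivity.Theorems.KLRegimeSplit

set_option linter.dupNamespace false -- summit = problem name (single-conjunct summit), D-0017

open Real Set Finset Literature.MathematicalPhysics.QuantumLattice Literature.Probability.LatticeModels
open Literature.MathematicalPhysics.QuantumLattice.BandSectorCounting
open Summit.HubbardSuperconductivity.HubbardSuperconductivity.Theorems.TwoPointAssembly
open Summit.HubbardSuperconductivity.HubbardSuperconductivity.Theorems.EngineV8
open Summit.HubbardSuperconductivity.HubbardSuperconductivity.Theorems.DispersionFlow
open Summit.HubbardSuperconductivity.HubbardSuperconductivity.Theorems.PerturbedFermiCurve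

/-! ## §1 Real quotients `G/s` and `G/s²` of a slice weight -/

/-- `|G(s)/s| ≤ M_G/r₁²` (`|G| ≤ M_G`, `G = 0` for `s ≤ r₁²`, `r₁ > 0`). -/
theorem klok_div_abs_le {G : ℝ → ℝ} {Mg r₁ : ℝ} (hbd : ∀ s, |G s| ≤ Mg) (hin : ∀ s, s ≤ r₁ ^ 2 → G s = 0) (hr₁ : 0 < r₁) (s : ℝ) :
    |G s / s| ≤ Mg / r₁ ^ 2 := by
  have h := klsp_div_norm_le (f := fun s => (G s : ℂ)) (fun s => by rw [Complex.norm_real, Real.norm_eq_abs]; exact hbd s)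
    (fun s hs => by rw [hin s hs, Complex.ofReal_zero]) hr₁ s
  rwa [← Complex.ofReal_div, Complex.norm_real, Real.norm_eq_abs] at h

/-- `G/s` is `(ℓ/r₁² + M_G/r₁⁴)`-Lipschitz (`G` `ℓ`-Lipschitz, `|G| ≤ M_G`, `G = 0` for `s ≤ r₁²`). -/
theorem klok_div_lipschitz {G : ℝ → ℝ} {Mg ℓ r₁ : ℝ} (hbd : ∀ s, |G s| ≤ Mg) (hlip : ∀ s s', |G s - G s'| ≤ ℓ * |s - s'|)
    (hin : ∀ s, s ≤ r₁ ^ 2 → G s = 0) (hr₁ : 0 < r₁) (s s' : ℝ) : |G s / s - G s' / s'| ≤ (ℓ / r₁ ^ 2 + Mg / r₁ ^ 4) * |s - s'| := by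
  have h := klsp_div_lipschitz (f := fun s => (G s : ℂ))
    (fun s s' => by rw [← Complex.ofReal_sub, Complex.norm_real, Real.norm_eq_abs]; exact hlip s s')
    (fun s => by rw [Complex.norm_real, Real.norm_eq_abs]; exact hbd s) (fun s hs => by rw [hin s hs, Complex.ofReal_zero]) hr₁ s s'
  rwa [← Complex.ofReal_div, ← Complex.ofReal_div, ← Complex.ofReal_sub, Complex.norm_real, Real.norm_eq_abs] at h

/-- `|G(s)/s²| ≤ M_G/r₁⁴`. -/
theorem klok_divSq_abs_le {G : ℝ → ℝ} {Mg r₁ : ℝ} (hbd : ∀ s, |G s| ≤ Mg) (hin : ∀ s, s ≤ r₁ ^ 2 → G s = 0) (hr₁ : 0 < r₁) (s : ℝ) :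
    |G s / s ^ 2| ≤ Mg / r₁ ^ 4 := by
  have h := klok_div_abs_le (G := fun s => G s / s) (Mg := Mg / r₁ ^ 2) (r₁ := r₁) (klok_div_abs_le hbd hin hr₁)
    (fun s hs => by simp only [hin s hs, zero_div]) hr₁ s
  simp only [div_div, ← sq] at h
  calc |G s / s ^ 2| ≤ Mg / (r₁ ^ 2) ^ 2 := h
    _ = Mg / r₁ ^ 4 := by ring

/-- `G/s²` is `(ℓ/r₁⁴ + 2M_G/r₁⁶)`-Lipschitz. -/
theorem klok_divSq_lipschitz {G : ℝ → ℝ} {Mg ℓ r₁ : ℝ} (hbd : ∀ s, |G s| ≤ Mg) (hlip : ∀ s s', |G s - G s'| ≤ ℓ * |s - s'|)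
    (hin : ∀ s, s ≤ r₁ ^ 2 → G s = 0) (hr₁ : 0 < r₁) (s s' : ℝ) :
    |G s / s ^ 2 - G s' / s' ^ 2| ≤ (ℓ / r₁ ^ 4 + 2 * Mg / r₁ ^ 6) * |s - s'| := by
  have h := klok_div_lipschitz (G := fun s => G s / s) (Mg := Mg / r₁ ^ 2) (ℓ := ℓ / r₁ ^ 2 + Mg / r₁ ^ 4) (r₁ := r₁)
    (klok_div_abs_le hbd hin hr₁) (klok_div_lipschitz hbd hlip hin hr₁) (fun s hs => by simp only [hin s hs, zero_div]) hr₁ s s'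
  simp only [div_div, ← sq] at h
  refine h.trans (le_of_eq ?_)
  congr 1
  field_simp
  ring

/-! ## §2 Radial Matsubara sums `S₁(e) = Σ_ν G(ω_ν² + e²)/(ω_ν² + e²)` and `S₂(e) = Σ_ν G(ω_ν² + e²)/(ω_ν² + e²)²` -/

section Sums

variable {M : ℕ} {β : ℝ}

/-- The frequencies that can contribute: `#{ν : ω_ν² < r₂²} ≤ r₂β/π + 1`. -/
theorem klok_card_freq_le (hβ : 0 < β) {r₂ : ℝ} (hr₂ : 0 ≤ r₂) :
    ((univ.filter fun ν : MatsubaraIdx M => matsubaraFreq β M ν ^ 2 < r₂ ^ 2).card : ℝ) ≤ r₂ * β / π + 1 :=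
  card_filter_matsubaraFreq_le_sharp hβ hr₂ _ fun _ hν => (abs_lt_of_sq_lt_sq (mem_filter.1 hν).2 hr₂).le

/-- A radial sum of a weight vanishing for `s ≥ r₂²` restricts to the frequencies `ω_ν² < r₂²`. -/
theorem klok_sum_radial_eq_sum_filter {g : ℝ → ℝ} {r₂ : ℝ} (hg : ∀ s, r₂ ^ 2 ≤ s → g s = 0) (e : ℝ) :
    ∑ ν : MatsubaraIdx M, g (matsubaraFreq β M ν ^ 2 + e ^ 2) =
      ∑ ν ∈ univ.filter (fun ν : MatsubaraIdx M => matsubaraFreq β M ν ^ 2 < r₂ ^ 2), g (matsubaraFreq β M ν ^ 2 + e ^ 2) := by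
  rw [sum_filter_of_ne]
  intro _ _ hne
  by_contra hlt
  exact hne (hg _ (by nlinarith [sq_nonneg e, not_lt.1 hlt]))

/-- A radial sum of a weight vanishing for `s ≥ r₂²` vanishes at levels `|e| ≥ r₂`. -/
theorem klok_sum_radial_eq_zero {g : ℝ → ℝ} {r₂ : ℝ} (hg : ∀ s, r₂ ^ 2 ≤ s → g s = 0) {e : ℝ} (he : r₂ ≤ |e|) (hr₂ : 0 ≤ r₂) :
    ∑ ν : MatsubaraIdx M, g (matsubaraFreq β M ν ^ 2 + e ^ 2) = 0 :=
  sum_eq_zero fun ν _ => hg _ (by nlinarith [sq_nonneg (matsubaraFreq β M ν), sq_abs e, abs_nonneg e])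

/-- **Bound of a radial Matsubara sum**: if `|g(s)| ≤ B` and `g(s) = 0` for `s ≥ r₂²` then `|Σ_ν g(ω_ν² + e²)| ≤ (r₂β/π + 1)·B`. -/
theorem klok_abs_sum_radial_le (hβ : 0 < β) {g : ℝ → ℝ} {B r₂ : ℝ} (hB : ∀ s, |g s| ≤ B) (hg : ∀ s, r₂ ^ 2 ≤ s → g s = 0)
    (hr₂ : 0 ≤ r₂) (e : ℝ) : |∑ ν : MatsubaraIdx M, g (matsubaraFreq β M ν ^ 2 + e ^ 2)| ≤ (r₂ * β / π + 1) * B := by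
  have hB0 : 0 ≤ B := (abs_nonneg _).trans (hB 0)
  rw [klok_sum_radial_eq_sum_filter hg e]
  refine (abs_sum_le_sum_abs _ _).trans ((sum_le_sum fun ν _ => hB _).trans ?_)
  rw [sum_const, nsmul_eq_mul]
  exact mul_le_mul_of_nonneg_right (klok_card_freq_le hβ hr₂) hB0

/-- **Increment of a radial Matsubara sum in the level**: if `g` is `Lg`-Lipschitz and `g(s) = 0` for `s ≥ r₂²` then
`|Σ_ν g(ω_ν² + e²) − Σ_ν g(ω_ν² + e′²)| ≤ (r₂β/π + 1)·Lg·|e² − e′²|`. -/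
theorem klok_abs_sum_radial_sub_le (hβ : 0 < β) {g : ℝ → ℝ} {Lg r₂ : ℝ} (hLg : ∀ s s', |g s - g s'| ≤ Lg * |s - s'|)
    (hg : ∀ s, r₂ ^ 2 ≤ s → g s = 0) (hr₂ : 0 ≤ r₂) (e e' : ℝ) :
    |∑ ν : MatsubaraIdx M, g (matsubaraFreq β M ν ^ 2 + e ^ 2) - ∑ ν : MatsubaraIdx M, g (matsubaraFreq β M ν ^ 2 + e' ^ 2)| ≤
      (r₂ * β / π + 1) * Lg * |e ^ 2 - e' ^ 2| := by
  have hLg0 : 0 ≤ Lg := by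
    have h := hLg 0 1
    have h0 : 0 ≤ |g 0 - g 1| := abs_nonneg _
    norm_num at h; linarith
  rw [klok_sum_radial_eq_sum_filter hg e, klok_sum_radial_eq_sum_filter hg e', ← sum_sub_distrib]
  refine (abs_sum_le_sum_abs _ _).trans ?_
  have hterm : ∀ ν ∈ univ.filter (fun ν : MatsubaraIdx M => matsubaraFreq β M ν ^ 2 < r₂ ^ 2),
      |g (matsubaraFreq β M ν ^ 2 + e ^ 2) - g (matsubaraFreq β M ν ^ 2 + e' ^ 2)| ≤ Lg * |e ^ 2 - e' ^ 2| := fun ν _ => by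
    have h := hLg (matsubaraFreq β M ν ^ 2 + e ^ 2) (matsubaraFreq β M ν ^ 2 + e' ^ 2)
    rwa [show matsubaraFreq β M ν ^ 2 + e ^ 2 - (matsubaraFreq β M ν ^ 2 + e' ^ 2) = e ^ 2 - e' ^ 2 by ring] at h
  refine (sum_le_sum hterm).trans ?_
  rw [sum_const, nsmul_eq_mul, mul_assoc]
  exact mul_le_mul_of_nonneg_right (klok_card_freq_le hβ hr₂) (by positivity)

end Sums

/-! ## §3 The odd level functions `e·S₁(e)` and `e³·S₂(e)`: Lipschitz on `[−ρ, ρ]` -/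

/-- **`e ↦ e·S(e)` is Lipschitz on `[−ρ, ρ]`** with constant `A + ρ·L·(2ρ)` when `|S| ≤ A` and `|S(e) − S(e′)| ≤ L·|e² − e′²|`. -/
theorem klok_odd₁_lipschitzOn {S : ℝ → ℝ} {A Lc ρ : ℝ} (hρ : 0 ≤ ρ) (hA : ∀ e, |S e| ≤ A) (hL : ∀ e e', |S e - S e'| ≤ Lc * |e ^ 2 - e' ^ 2|) :
    LipschitzOnWith (Real.toNNReal (A + ρ * Lc * (2 * ρ))) (fun e => e * S e) (Icc (-ρ) ρ) := by
  have hA0 : 0 ≤ A := (abs_nonneg _).trans (hA 0)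
  have hLc0 : 0 ≤ Lc := by
    by_contra h
    have h1 := hL 1 0
    have : |S 1 - S 0| < 0 := h1.trans_lt (by norm_num; linarith [not_le.1 h])
    linarith [abs_nonneg (S 1 - S 0)]
  refine LipschitzOnWith.of_dist_le' fun e he e' he' => ?_
  rw [Real.dist_eq, Real.dist_eq]
  have hee' : |e ^ 2 - e' ^ 2| ≤ 2 * ρ * |e - e'| := by
    rw [show e ^ 2 - e' ^ 2 = (e + e') * (e - e') by ring, abs_mul]
    refine mul_le_mul_of_nonneg_right ((abs_add_le _ _).trans ?_) (abs_nonneg _)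
    have h1 := abs_le.2 ⟨he.1, he.2⟩; have h2 := abs_le.2 ⟨he'.1, he'.2⟩; linarith
  have he'abs : |e'| ≤ ρ := abs_le.2 ⟨he'.1, he'.2⟩
  calc |e * S e - e' * S e'| = |(e - e') * S e + e' * (S e - S e')| := by ring_nf
    _ ≤ |e - e'| * |S e| + |e'| * |S e - S e'| := by
        refine (abs_add_le _ _).trans ?_; rw [abs_mul, abs_mul]
    _ ≤ |e - e'| * A + ρ * (Lc * (2 * ρ * |e - e'|)) := by
        gcongr
        · exact hA e
        · exact (hL e e').trans (mul_le_mul_of_nonneg_left hee' hLc0)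
    _ = (A + ρ * Lc * (2 * ρ)) * |e - e'| := by ring

/-- **`e ↦ e³·S(e)` is Lipschitz on `[−ρ, ρ]`** with constant `3ρ²·A + ρ³·L·(2ρ)` when `|S| ≤ A` and `|S(e) − S(e′)| ≤ L·|e² − e′²|`. -/
theorem klok_odd₃_lipschitzOn {S : ℝ → ℝ} {A Lc ρ : ℝ} (hρ : 0 ≤ ρ) (hA : ∀ e, |S e| ≤ A) (hL : ∀ e e', |S e - S e'| ≤ Lc * |e ^ 2 - e' ^ 2|) :
    LipschitzOnWith (Real.toNNReal (3 * ρ ^ 2 * A + ρ ^ 3 * Lc * (2 * ρ))) (fun e => e ^ 3 * S e) (Icc (-ρ) ρ) := by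
  have hA0 : 0 ≤ A := (abs_nonneg _).trans (hA 0)
  have hLc0 : 0 ≤ Lc := by
    by_contra h
    have h1 := hL 1 0
    have : |S 1 - S 0| < 0 := h1.trans_lt (by norm_num; linarith [not_le.1 h])
    linarith [abs_nonneg (S 1 - S 0)]
  refine LipschitzOnWith.of_dist_le' fun e he e' he' => ?_
  rw [Real.dist_eq, Real.dist_eq]
  have h1 := abs_le.2 ⟨he.1, he.2⟩
  have h2 := abs_le.2 ⟨he'.1, he'.2⟩
  have hee' : |e ^ 2 - e' ^ 2| ≤ 2 * ρ * |e - e'| := by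
    rw [show e ^ 2 - e' ^ 2 = (e + e') * (e - e') by ring, abs_mul]
    exact mul_le_mul_of_nonneg_right ((abs_add_le _ _).trans (by linarith)) (abs_nonneg _)
  have hcube : |e ^ 3 - e' ^ 3| ≤ 3 * ρ ^ 2 * |e - e'| := by
    rw [show e ^ 3 - e' ^ 3 = (e ^ 2 + e * e' + e' ^ 2) * (e - e') by ring, abs_mul]
    refine mul_le_mul_of_nonneg_right ?_ (abs_nonneg _)
    calc |e ^ 2 + e * e' + e' ^ 2| ≤ |e ^ 2| + |e * e'| + |e' ^ 2| := abs_add_three _ _ _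
      _ ≤ ρ ^ 2 + ρ * ρ + ρ ^ 2 := by
          rw [abs_pow, abs_mul, abs_pow]
          gcongr
      _ = 3 * ρ ^ 2 := by ring
  have he'3 : |e'| ^ 3 ≤ ρ ^ 3 := pow_le_pow_left₀ (abs_nonneg _) h2 3
  calc |e ^ 3 * S e - e' ^ 3 * S e'| = |(e ^ 3 - e' ^ 3) * S e + e' ^ 3 * (S e - S e')| := by ring_nf
    _ ≤ |e ^ 3 - e' ^ 3| * |S e| + |e'| ^ 3 * |S e - S e'| := by
        refine (abs_add_le _ _).trans ?_; rw [abs_mul, abs_mul, abs_pow]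
    _ ≤ 3 * ρ ^ 2 * |e - e'| * A + ρ ^ 3 * (Lc * (2 * ρ * |e - e'|)) := by
        gcongr
        · exact hA e
        · exact (hL e e').trans (mul_le_mul_of_nonneg_left hee' hLc0)
    _ = (3 * ρ ^ 2 * A + ρ ^ 3 * Lc * (2 * ρ)) * |e - e'| := by ring

/-! ## §4 THE LOCALISED BORN KERNEL SUM over all frequency–momenta -/

/-- The even factor `Σ_ν a(ν)(e² − ω_ν²)/(ω_ν² + e²)²` of `klod_sum_even_mul_propCT_sq` in terms of the radial sums: for `s_ν = ω_ν² + e² ≠ 0`,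
`Σ_ν G(s_ν)(e² − ω_ν²)/s_ν² = 2e²·Σ_ν G(s_ν)/s_ν² − Σ_ν G(s_ν)/s_ν` (`e² − ω² = 2e² − s`). -/
theorem klok_sum_sqDiff_eq {M : ℕ} {β : ℝ} (hβ : β ≠ 0) (G : ℝ → ℝ) (e : ℝ) :
    ∑ ν : MatsubaraIdx M, G (matsubaraFreq β M ν ^ 2 + e ^ 2) * (e ^ 2 - matsubaraFreq β M ν ^ 2) / (matsubaraFreq β M ν ^ 2 + e ^ 2) ^ 2 =
      2 * e ^ 2 * ∑ ν : MatsubaraIdx M, G (matsubaraFreq β M ν ^ 2 + e ^ 2) / (matsubaraFreq β M ν ^ 2 + e ^ 2) ^ 2 -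
        ∑ ν : MatsubaraIdx M, G (matsubaraFreq β M ν ^ 2 + e ^ 2) / (matsubaraFreq β M ν ^ 2 + e ^ 2) := by
  rw [mul_sum, ← sum_sub_distrib]
  refine sum_congr rfl fun ν _ => ?_
  have hω : matsubaraFreq β M ν ≠ 0 := matsubaraFreq_ne_zero hβ ν
  have hs : matsubaraFreq β M ν ^ 2 + e ^ 2 ≠ 0 := by positivity
  field_simp
  ring

/-- **THE LOCALISED BORN KERNEL SUM (brick O5a).**  For a real slice weight `G` (`|G| ≤ M_G`, `ℓ`-Lipschitz, `G = 0` for `s ≤ r₁²` and for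
`s ≥ r₂²`, `0 < r₁`, `0 < r₂`), coefficients `zω ze : ℂ`, under the C4a chart hypotheses with `r₂ + (4 + 2A)·2π/L < r` and `0 < β`:
`‖Σ_{(ν,k̃)} G(ω_ν² + e_K(p_k̃)²)·ĝ_K(ν,k̃)²·(zω·iω_ν + ze·e_K(p_k̃))‖ ≤ (‖2zω + ze‖·C₁ + 2‖zω + ze‖·C₃)·r₂·(L/2π)²·(4π·jacR·r₂² + 4Dδ)` with
`N = r₂β/π + 1`, `C₁ = N·M_G/r₁² + 2r₂·(N·(ℓ/r₁² + M_G/r₁⁴))·(4r₂)`, `C₃ = 3(2r₂)²·N·M_G/r₁⁴ + (2r₂)³·(N·(ℓ/r₁⁴ + 2M_G/r₁⁶))·(4r₂)`,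
`D = 2π·π√2/(Dt_min − 2A)`, `δ = (4 + 2A)·2π/L` — the DOS-SLOPE size (CURE-C-PRIME-DESIGN §2 row 1), not the DOS size of the generic born row.
[cite: BenfattoGiulianiMastropietro2006, §2.9, §2.4 (2.40)–(2.41)] [cite: FeldmanSalmhoferTrubowitz1998, App. B] -/
theorem klok_localisedBorn_sum_norm_le {L M : ℕ} [NeZero L] [NeZero M] {β : ℝ} (hβ : 0 < β) (μ : ℝ) {K : TrigPolyC4v}
    {a b : ℝ} (B : BandBounds a b) {A : ℝ} (hA : ∀ p : Momentum, ∀ j ≤ 2, ‖iteratedFDeriv ℝ j (frameShift K) p‖ ≤ A) (hADt : 2 * A < B.Dtmin)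
    {r : ℝ} (hlo : a < μ - r - A) (hhi : μ + r + A < b)
    {G : ℝ → ℝ} {Mg ℓ r₁ r₂ : ℝ} (hbd : ∀ s, |G s| ≤ Mg) (hlip : ∀ s s', |G s - G s'| ≤ ℓ * |s - s'|)
    (hin : ∀ s, s ≤ r₁ ^ 2 → G s = 0) (hout : ∀ s, r₂ ^ 2 ≤ s → G s = 0) (hr₁ : 0 < r₁) (hr₂ : 0 < r₂)
    (hr₂r : r₂ + (4 + 2 * A) * (2 * π / L) < r) (zω ze : ℂ) :
    ‖∑ p : FreqMomentum L M, (G (matsubaraFreq β M p.1 ^ 2 + nambuXiCT L μ K p.2 ^ 2) : ℂ) *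
        (propCT L M β μ K p ^ 2 * (zω * (Complex.I * (matsubaraFreq β M p.1 : ℂ)) + ze * (nambuXiCT L μ K p.2 : ℂ)))‖ ≤
      (‖2 * zω + ze‖ * ((r₂ * β / π + 1) * (Mg / r₁ ^ 2) + 2 * r₂ * ((r₂ * β / π + 1) * (ℓ / r₁ ^ 2 + Mg / r₁ ^ 4)) * (2 * (2 * r₂))) +
        2 * ‖zω + ze‖ * (3 * (2 * r₂) ^ 2 * ((r₂ * β / π + 1) * (Mg / r₁ ^ 4)) +
          (2 * r₂) ^ 3 * ((r₂ * β / π + 1) * (ℓ / r₁ ^ 4 + 2 * Mg / r₁ ^ 6)) * (2 * (2 * r₂)))) *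
      (r₂ * (((L : ℝ) / (2 * π)) ^ 2 *
        (4 * π * (1 / (B.Dtmin - 2 * A) ^ 2 + Real.pi * Real.sqrt 2 * (2 + 4 * A) / (B.Dtmin - 2 * A) ^ 3) * r₂ ^ 2 +
          4 * (2 * π * (π * Real.sqrt 2 / (B.Dtmin - 2 * A))) * ((4 + 2 * A) * (2 * π / L))))) := by
  have hβ0 : β ≠ 0 := hβ.ne'
  have hπ := Real.pi_pos
  -- the radial sums and their data
  obtain ⟨S₁, hS₁⟩ : ∃ f : ℝ → ℝ, ∀ e, f e = ∑ ν : MatsubaraIdx M, G (matsubaraFreq β M ν ^ 2 + e ^ 2) / (matsubaraFreq β M ν ^ 2 + e ^ 2) :=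
    ⟨_, fun _ => rfl⟩
  obtain ⟨S₂, hS₂⟩ : ∃ f : ℝ → ℝ, ∀ e, f e = ∑ ν : MatsubaraIdx M, G (matsubaraFreq β M ν ^ 2 + e ^ 2) / (matsubaraFreq β M ν ^ 2 + e ^ 2) ^ 2 :=
    ⟨_, fun _ => rfl⟩
  have hg₁out : ∀ s, r₂ ^ 2 ≤ s → G s / s = 0 := fun s hs => by rw [hout s hs, zero_div]
  have hg₂out : ∀ s, r₂ ^ 2 ≤ s → G s / s ^ 2 = 0 := fun s hs => by rw [hout s hs, zero_div]
  have hA₁ : ∀ e, |S₁ e| ≤ (r₂ * β / π + 1) * (Mg / r₁ ^ 2) := fun e => by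
    rw [hS₁]; exact klok_abs_sum_radial_le hβ (g := fun s => G s / s) (klok_div_abs_le hbd hin hr₁) hg₁out hr₂.le e
  have hL₁ : ∀ e e', |S₁ e - S₁ e'| ≤ (r₂ * β / π + 1) * (ℓ / r₁ ^ 2 + Mg / r₁ ^ 4) * |e ^ 2 - e' ^ 2| := fun e e' => by
    rw [hS₁, hS₁]; exact klok_abs_sum_radial_sub_le hβ (g := fun s => G s / s) (klok_div_lipschitz hbd hlip hin hr₁) hg₁out hr₂.le e e'
  have hA₂ : ∀ e, |S₂ e| ≤ (r₂ * β / π + 1) * (Mg / r₁ ^ 4) := fun e => by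
    rw [hS₂]; exact klok_abs_sum_radial_le hβ (g := fun s => G s / s ^ 2) (klok_divSq_abs_le hbd hin hr₁) hg₂out hr₂.le e
  have hL₂ : ∀ e e', |S₂ e - S₂ e'| ≤ (r₂ * β / π + 1) * (ℓ / r₁ ^ 4 + 2 * Mg / r₁ ^ 6) * |e ^ 2 - e' ^ 2| := fun e e' => by
    rw [hS₂, hS₂]; exact klok_abs_sum_radial_sub_le hβ (g := fun s => G s / s ^ 2) (klok_divSq_lipschitz hbd hlip hin hr₁) hg₂out hr₂.le e e'
  -- the odd level functions `e·S₁(e)` and `e³·S₂(e)`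
  have hS₁0 : ∀ e, r₂ ≤ |e| → S₁ e = 0 := fun e he => by rw [hS₁]; exact klok_sum_radial_eq_zero (g := fun s => G s / s) hg₁out he hr₂.le
  have hS₂0 : ∀ e, r₂ ≤ |e| → S₂ e = 0 := fun e he => by rw [hS₂]; exact klok_sum_radial_eq_zero (g := fun s => G s / s ^ 2) hg₂out he hr₂.le
  have hPodd : ∀ e, (-e) * S₁ (-e) = -(e * S₁ e) := fun e => by rw [hS₁, hS₁]; simp only [neg_sq]; ring
  have hQodd : ∀ e, (-e) ^ 3 * S₂ (-e) = -(e ^ 3 * S₂ e) := fun e => by rw [hS₂, hS₂]; simp only [neg_sq]; ring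
  have h2r : 0 ≤ 2 * r₂ := by positivity
  have hPsum := abs_sum_shell_odd_le_of_lipschitzOn B hA hADt hlo hhi (L := L) (fun e => e * S₁ e) hr₂.le (by linarith : r₂ < 2 * r₂) hr₂r
    hPodd (klok_odd₁_lipschitzOn h2r hA₁ hL₁)
  have hQsum := abs_sum_shell_odd_le_of_lipschitzOn B hA hADt hlo hhi (L := L) (fun e => e ^ 3 * S₂ e) hr₂.le (by linarith : r₂ < 2 * r₂) hr₂r
    hQodd (klok_odd₃_lipschitzOn h2r hA₂ hL₂)
  have hC₁ : 0 ≤ (r₂ * β / π + 1) * (Mg / r₁ ^ 2) + 2 * r₂ * ((r₂ * β / π + 1) * (ℓ / r₁ ^ 2 + Mg / r₁ ^ 4)) * (2 * (2 * r₂)) := by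
    have hMg : 0 ≤ Mg := (abs_nonneg _).trans (hbd 0)
    have hℓ : 0 ≤ ℓ := by
      have h := hlip 0 1; have h0 : 0 ≤ |G 0 - G 1| := abs_nonneg _; norm_num at h; linarith
    positivity
  have hC₃ : 0 ≤ 3 * (2 * r₂) ^ 2 * ((r₂ * β / π + 1) * (Mg / r₁ ^ 4)) +
      (2 * r₂) ^ 3 * ((r₂ * β / π + 1) * (ℓ / r₁ ^ 4 + 2 * Mg / r₁ ^ 6)) * (2 * (2 * r₂)) := by
    have hMg : 0 ≤ Mg := (abs_nonneg _).trans (hbd 0)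
    have hℓ : 0 ≤ ℓ := by
      have h := hlip 0 1; have h0 : 0 ≤ |G 0 - G 1| := abs_nonneg _; norm_num at h; linarith
    positivity
  rw [Real.coe_toNNReal _ hC₁] at hPsum
  rw [Real.coe_toNNReal _ hC₃] at hQsum
  -- the full momentum sums equal the shell sums
  have hPall : ∑ k : TorusSite 2 L, nambuXiCT L μ K k * S₁ (nambuXiCT L μ K k) =
      ∑ k ∈ univ.filter (fun k : TorusSite 2 L => |nambuXiCT L μ K k| ≤ r₂), nambuXiCT L μ K k * S₁ (nambuXiCT L μ K k) := by
    rw [sum_filter_of_ne]; intro k _ hne; by_contra hlt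
    exact hne (by rw [hS₁0 _ (not_le.1 hlt).le, mul_zero])
  have hQall : ∑ k : TorusSite 2 L, nambuXiCT L μ K k ^ 3 * S₂ (nambuXiCT L μ K k) =
      ∑ k ∈ univ.filter (fun k : TorusSite 2 L => |nambuXiCT L μ K k| ≤ r₂), nambuXiCT L μ K k ^ 3 * S₂ (nambuXiCT L μ K k) := by
    rw [sum_filter_of_ne]; intro k _ hne; by_contra hlt
    exact hne (by rw [hS₂0 _ (not_le.1 hlt).le, mul_zero])
  -- the frequency sum at fixed momentum (O1 §5)
  have hinner : ∀ k : TorusSite 2 L,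
      ∑ ν : MatsubaraIdx M, (G (matsubaraFreq β M ν ^ 2 + nambuXiCT L μ K k ^ 2) : ℂ) *
        (propCT L M β μ K (ν, k) ^ 2 * (zω * (Complex.I * (matsubaraFreq β M ν : ℂ)) + ze * (nambuXiCT L μ K k : ℂ))) =
      -(2 * zω + ze) * ((nambuXiCT L μ K k * S₁ (nambuXiCT L μ K k) : ℝ) : ℂ) +
        2 * (zω + ze) * ((nambuXiCT L μ K k ^ 3 * S₂ (nambuXiCT L μ K k) : ℝ) : ℂ) := by
    intro k
    rw [klod_sum_even_mul_propCT_sq_mul_linForm μ K hβ0 (fun ν => G (matsubaraFreq β M ν ^ 2 + nambuXiCT L μ K k ^ 2))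
      (fun ν => by simp only [matsubaraFreq_rev, neg_sq]) zω ze k]
    simp only [klok_sum_sqDiff_eq hβ0 G (nambuXiCT L μ K k), ← hS₁, ← hS₂]
    push_cast
    ring
  -- assemble
  have hsum : ∑ p : FreqMomentum L M, (G (matsubaraFreq β M p.1 ^ 2 + nambuXiCT L μ K p.2 ^ 2) : ℂ) *
        (propCT L M β μ K p ^ 2 * (zω * (Complex.I * (matsubaraFreq β M p.1 : ℂ)) + ze * (nambuXiCT L μ K p.2 : ℂ))) =
      -(2 * zω + ze) * ((∑ k ∈ univ.filter (fun k : TorusSite 2 L => |nambuXiCT L μ K k| ≤ r₂), nambuXiCT L μ K k * S₁ (nambuXiCT L μ K k) : ℝ) : ℂ) +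
        2 * (zω + ze) * ((∑ k ∈ univ.filter (fun k : TorusSite 2 L => |nambuXiCT L μ K k| ≤ r₂), nambuXiCT L μ K k ^ 3 * S₂ (nambuXiCT L μ K k) : ℝ) : ℂ) := by
    rw [Fintype.sum_prod_type, Finset.sum_comm]
    simp only [hinner]
    rw [sum_add_distrib, ← mul_sum, ← mul_sum, ← Complex.ofReal_sum, ← Complex.ofReal_sum, hPall, hQall]
  rw [hsum]
  calc ‖-(2 * zω + ze) * ((∑ k ∈ univ.filter (fun k : TorusSite 2 L => |nambuXiCT L μ K k| ≤ r₂), nambuXiCT L μ K k * S₁ (nambuXiCT L μ K k) : ℝ) : ℂ) +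
        2 * (zω + ze) * ((∑ k ∈ univ.filter (fun k : TorusSite 2 L => |nambuXiCT L μ K k| ≤ r₂), nambuXiCT L μ K k ^ 3 * S₂ (nambuXiCT L μ K k) : ℝ) : ℂ)‖
      ≤ ‖2 * zω + ze‖ * |∑ k ∈ univ.filter (fun k : TorusSite 2 L => |nambuXiCT L μ K k| ≤ r₂), nambuXiCT L μ K k * S₁ (nambuXiCT L μ K k)| +
        2 * ‖zω + ze‖ * |∑ k ∈ univ.filter (fun k : TorusSite 2 L => |nambuXiCT L μ K k| ≤ r₂), nambuXiCT L μ K k ^ 3 * S₂ (nambuXiCT L μ K k)| := by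
        refine (norm_add_le _ _).trans (le_of_eq ?_)
        rw [norm_mul, norm_mul, norm_neg, Complex.norm_real, Complex.norm_real, norm_mul, Complex.norm_two, Real.norm_eq_abs, Real.norm_eq_abs]
    _ ≤ ‖2 * zω + ze‖ * ((r₂ * (((r₂ * β / π + 1) * (Mg / r₁ ^ 2) + 2 * r₂ * ((r₂ * β / π + 1) * (ℓ / r₁ ^ 2 + Mg / r₁ ^ 4)) * (2 * (2 * r₂))) *
          (((L : ℝ) / (2 * π)) ^ 2 * (4 * π * (1 / (B.Dtmin - 2 * A) ^ 2 + Real.pi * Real.sqrt 2 * (2 + 4 * A) / (B.Dtmin - 2 * A) ^ 3) * r₂ ^ 2 +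
            4 * (2 * π * (π * Real.sqrt 2 / (B.Dtmin - 2 * A))) * ((4 + 2 * A) * (2 * π / L))))))) +
        2 * ‖zω + ze‖ * ((r₂ * ((3 * (2 * r₂) ^ 2 * ((r₂ * β / π + 1) * (Mg / r₁ ^ 4)) +
          (2 * r₂) ^ 3 * ((r₂ * β / π + 1) * (ℓ / r₁ ^ 4 + 2 * Mg / r₁ ^ 6)) * (2 * (2 * r₂))) *
          (((L : ℝ) / (2 * π)) ^ 2 * (4 * π * (1 / (B.Dtmin - 2 * A) ^ 2 + Real.pi * Real.sqrt 2 * (2 + 4 * A) / (B.Dtmin - 2 * A) ^ 3) * r₂ ^ 2 +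
            4 * (2 * π * (π * Real.sqrt 2 / (B.Dtmin - 2 * A))) * ((4 + 2 * A) * (2 * π / L))))))) :=
        add_le_add (mul_le_mul_of_nonneg_left hPsum (norm_nonneg _)) (mul_le_mul_of_nonneg_left hQsum (by positivity))
    _ = _ := by ring

/-! ## §5 The rows door's born kernel `G = Ẇ_t·Φ_j` as a slice weight -/

/-- **The born kernel's radial weight**: `G(s) = klWd Λ_t s · klPhi Λ_j Λ_t s` (`0 < Λ_j ≤ Λ_t`) satisfies `|G| ≤ 8/Λ_t`, is
`(64/(Λ_t·Λ_j²) + (2·(448/3)e² + 8)/Λ_t³)`-Lipschitz, and vanishes for `s ≤ (Λ_t/2)²` and for `s ≥ Λ_t²`. -/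
theorem klok_bornKernel_hypotheses {Λt Λj : ℝ} (hΛt : 0 < Λt) (hΛj : 0 < Λj) (hle : Λj ≤ Λt) :
    (∀ s, |klWd Λt s * klPhi Λj Λt s| ≤ 8 / Λt) ∧
    (∀ s s', |klWd Λt s * klPhi Λj Λt s - klWd Λt s' * klPhi Λj Λt s'| ≤ (64 / (Λt * Λj ^ 2) + (2 * (448 / 3 * Real.exp 2) + 8) / Λt ^ 3) * |s - s'|) ∧
    (∀ s, s ≤ (Λt / 2) ^ 2 → klWd Λt s * klPhi Λj Λt s = 0) ∧ (∀ s, Λt ^ 2 ≤ s → klWd Λt s * klPhi Λj Λt s = 0) := by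
  refine ⟨fun s => ?_, fun s s' => ?_, fun s hs => ?_, fun s hs => ?_⟩
  · rw [abs_mul]
    calc |klWd Λt s| * |klPhi Λj Λt s| ≤ 8 / Λt * 1 :=
          mul_le_mul (abs_klWd_le hΛt s) (abs_klPhi_le_one Λj Λt s) (abs_nonneg _) (by positivity)
      _ = 8 / Λt := mul_one _
  · have e : klWd Λt s * klPhi Λj Λt s - klWd Λt s' * klPhi Λj Λt s' =
        klWd Λt s * (klPhi Λj Λt s - klPhi Λj Λt s') + (klWd Λt s - klWd Λt s') * klPhi Λj Λt s' := by ring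
    rw [e]
    refine (abs_add_le _ _).trans ?_
    rw [abs_mul, abs_mul]
    have h1 := mul_le_mul (abs_klWd_le hΛt s) (klPhi_lipschitz hΛj hle s s') (abs_nonneg _) (by positivity)
    have h2 := mul_le_mul (klWd_lipschitz hΛt s s') (abs_klPhi_le_one Λj Λt s') (abs_nonneg _) (by positivity)
    have e2 : 8 / Λt * (8 / Λj ^ 2 * |s - s'|) + (2 * (448 / 3 * Real.exp 2) + 8) / Λt ^ 3 * |s - s'| * 1 =
        (64 / (Λt * Λj ^ 2) + (2 * (448 / 3 * Real.exp 2) + 8) / Λt ^ 3) * |s - s'| := by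
      field_simp; ring
    linarith [h1, h2, e2.le, e2.ge]
  · rw [klWd_eq_zero_of_le hΛt (by nlinarith), zero_mul]
  · rw [klWd_eq_zero_of_ge hΛt hs, zero_mul]

/-- **The born kernel in the rows door's spelling**: `klfb_prop (klWdC Λ_t) ω e · klfb_prop (klPhiC Λ_j Λ_t) ω e = (Ẇ_tΦ_j)(ω² + e²)·ĝ²` at a
frequency–momentum `p` (`β ≠ 0`; dictionary `klfw_klfb_prop_eq`). -/
theorem klok_bornKernel_klfb_eq {L M : ℕ} [NeZero L] [NeZero M] {β : ℝ} (hβ : β ≠ 0) (μ : ℝ) (K : TrigPolyC4v) (Λt Λj : ℝ)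
    (p : FreqMomentum L M) :
    klfb_prop (klWdC Λt) (matsubaraFreq β M p.1) (nambuXiCT L μ K p.2) * klfb_prop (klPhiC Λj Λt) (matsubaraFreq β M p.1) (nambuXiCT L μ K p.2) =
      ((klWd Λt (matsubaraFreq β M p.1 ^ 2 + nambuXiCT L μ K p.2 ^ 2) * klPhi Λj Λt (matsubaraFreq β M p.1 ^ 2 + nambuXiCT L μ K p.2 ^ 2) : ℝ) : ℂ) *
        propCT L M β μ K p ^ 2 := by
  rw [klfw_klfb_prop_eq μ K hβ, klfw_klfb_prop_eq μ K hβ, klWdC, klPhiC]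
  push_cast
  ring

end Summit.HubbardSuperconductivity.HubbardSuperconductivity.Theorems.KLRegimeSplit

end
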